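import Mathlib
import HarnessLib

/-!
# The log–log weighted least-squares scaling exponent: closed form, invariances, optimality, error bar

HONEST FRAMING: exact (Metropolis-corrected) sampling algorithms for lattice gauge theory;
figures of merit are autocorrelation/cost numbers at stated couplings and volumes; no
continuum-physics claim.

Venture `LatticeQCDFlow` (cell pub-lqcd), sub-topic `Scoring`; FANOUT row 7 (`s0-cpn-null`, the
S0-D1 rung: 2D CP⁹, leading-order trivializing map inside HMC vs HMC; deliverable "continuum-scaling
exponents of τ_int(Q) for both", acceptance "exponents equal within 2σ_comb (null result
reproduced)").  NEW WORK of the cell (finite real algebra over Mathlib); nothing is cited as a fact.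
Printed counterparts, named only: Engel–Schaefer 2011 §5 (τ_int ∝ ξ^z fits, `z ≈ 4` for `Q²` with
and without the map), Wolff 2004 / Schaefer–Sommer–Virotta 2011 (the error bars fed in).

## The rule this file types (HOME/s0-cpn-null/EXPONENT-REPORT-S0-D1.md, method paragraph)

Per algorithm, the exponent `z` of `τ_int(O) = A ξ^z` is the WEIGHTED LEAST-SQUARES SLOPE of
`yᵢ = ln τ_int(O; βᵢ)` on `xᵢ = ln ξ_G(βᵢ)` with weights `wᵢ = (τᵢ/δτᵢ)²` (= `1/Var(yᵢ)` to first
order), the two algorithms sharing the abscissae; `δz² = S₀/Δ` (below); the verdict statistic is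
`(z_THMC − z_HMC)/σ_comb`, `σ_comb = √(δz_HMC² + δz_THMC²)`, and the rung's null is reproduced when
its modulus is `≤ 2`.  With the weighted sums `S₀ = Σw`, `Sₓ = Σwx`, `Sₓₓ = Σwx²`, `S_y = Σwy`,
`S_xy = Σwxy` and `Δ = S₀Sₓₓ − Sₓ²`:

* `fitSlope = (S₀S_xy − SₓS_y)/Δ`, `fitIntercept = (SₓₓS_y − SₓS_xy)/Δ` (`ln A`), `fitChiSq b z =
  Σ w (y − b − zx)²`; `two_mul_fitDet` — **`2Δ = Σᵢⱼ wᵢwⱼ(xᵢ − xⱼ)²`**, so `Δ ≥ 0` for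
  non-negative weights (`fitDet_nonneg`) and `Δ > 0` as soon as two abscissae differ
  (`fitDet_pos`: the fit exists iff the card has two distinct `ξ`);
* `fitSlope_eq_sum_fitCoef`, `sum_fitCoef`, `sum_fitCoef_mul` — **the exponent is LINEAR in the
  data**: `z = Σ cᵢ yᵢ`, `cᵢ = wᵢ(S₀xᵢ − Sₓ)/Δ`, `Σcᵢ = 0`, `Σcᵢxᵢ = 1`;
* hence the two facts the rung's logic rests on: **`fitSlope_add_const`** — multiplying every
  `τᵢ` by one `ξ`-independent factor (`yᵢ ↦ yᵢ + c`) leaves `z` unchanged: a constant-factor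
  speed-up, or a constant per-trajectory cost factor, CANNOT move the scaling exponent — and
  **`fitSlope_add_affine`** — a factor growing like `ξ^a` (`yᵢ ↦ yᵢ + a xᵢ + c`) moves it by
  EXACTLY `a` (so `z_cost = z + a` when cost/trajectory `= Cξ^a`); `fitSlope_affine`,
  `fitIntercept_affine` — the estimator is exact on pure power laws; `fitSlope_smul_weight` — a
  common rescaling of the weights is immaterial;
* `fitIntercept_normalEq`, `fitSlope_normalEq`, **`fitChiSq_eq_add`**, `fitChiSq_min` — the normal
  equations and `χ²(b, z) = χ²(b̂, ẑ) + Σ w ((b − b̂) + (z − ẑ)x)²`: the closed form IS the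
  least-squares minimiser (non-negative weights);
* **`sum_fitCoef_sq_div`** — `Σ cᵢ²/wᵢ = S₀/Δ`: with independent `yᵢ` of variance `1/wᵢ` the
  propagated variance of `z` is `S₀/Δ` — the printed `δz`; it depends on the weights and abscissae
  only, NOT on the ordinates;
* `sigmaComb`, `exponentZ` (the verdict statistic), `exponentZ_add` — a common shift of both
  exponents leaves it unchanged; with `fitSlope_add_affine`: **`exponentZ_costUnits`** — the
  verdict in cost units (`τ × cost/traj`) equals the verdict in MD units whenever both arms'
  per-trajectory costs are `C_arm ξ^a` with a COMMON `a` (row 7: HMC and THMC at equal trajectory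
  length on equal volumes, cost ratio `×1.6` at every β) — the error bars being ordinate-free;
* record numbers of the rung on the printed roundings (public after the unseal of 2026-08-21,
  HOME/s0-ref/UNSEAL-S0-D1.md; HOME/s0-cpn-null/COMMIT-S0-D1-v1.md §2–§3):
  `s0d1_exponents_within`: `|4.10 − 4.18| < 1·√(0.17² + 0.16²)` (so a fortiori within `2σ_comb`);
  `s0d1_ratios_within`: the three τ_int(Q²) ratios ours/sealed `0.795/0.741`, `0.715/0.767`,
  `0.87/0.672` lie in `[0.5, 2]`.

What is NOT here: that `δz² = S₀/Δ` is the variance of `z` needs independent points and true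
(not Γ-estimated) error bars, and `ln` linearised — modelling assumptions of the report, stated in
its method paragraph, not algebra; no claim that three points discriminate a power from an
exponential law (the report says they do not).
-/

noncomputable section

namespace Summit.Ventures.LatticeQCDFlow.Scoring

open Finset

variable {ι : Type*} (s : Finset ι) (w x y : ι → ℝ)

/-! ## Weighted sums and the closed form -/

/-- `S₀ = Σᵢ wᵢ`. -/
def fitS0 : ℝ := ∑ i ∈ s, w i
/-- `Sₓ = Σᵢ wᵢ xᵢ`. -/
def fitSx : ℝ := ∑ i ∈ s, w i * x i
/-- `Sₓₓ = Σᵢ wᵢ xᵢ²`. -/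
def fitSxx : ℝ := ∑ i ∈ s, w i * x i ^ 2
/-- `S_y = Σᵢ wᵢ yᵢ`. -/
def fitSy : ℝ := ∑ i ∈ s, w i * y i
/-- `S_xy = Σᵢ wᵢ xᵢ yᵢ`. -/
def fitSxy : ℝ := ∑ i ∈ s, w i * (x i * y i)
/-- The determinant of the normal equations `Δ = S₀Sₓₓ − Sₓ²`. -/
def fitDet : ℝ := fitS0 s w * fitSxx s w x - fitSx s w x ^ 2
/-- **The fitted exponent**: the weighted least-squares slope `z = (S₀S_xy − SₓS_y)/Δ` of `y` on `x`
(`x = ln ξ`, `y = ln τ_int`).  Junk value `0` when `Δ = 0` (fewer than two distinct abscissae). -/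
def fitSlope : ℝ := (fitS0 s w * fitSxy s w x y - fitSx s w x * fitSy s w y) / fitDet s w x
/-- The fitted intercept `ln A = (SₓₓS_y − SₓS_xy)/Δ`. -/
def fitIntercept : ℝ := (fitSxx s w x * fitSy s w y - fitSx s w x * fitSxy s w x y) / fitDet s w x
/-- The weighted sum of squared residuals of the line `b + z x`: `χ²(b, z) = Σ w (y − b − zx)²`. -/
def fitChiSq (b z : ℝ) : ℝ := ∑ i ∈ s, w i * (y i - (b + z * x i)) ^ 2
/-- The coefficient of `yᵢ` in the fitted exponent: `cᵢ = wᵢ(S₀xᵢ − Sₓ)/Δ`. -/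
def fitCoef (i : ι) : ℝ := w i * (fitS0 s w * x i - fitSx s w x) / fitDet s w x

/-! ## `Δ` as a sum of squares -/

/-- **Lagrange's identity for the determinant**: `2Δ = Σᵢ Σⱼ wᵢ wⱼ (xᵢ − xⱼ)²`. -/
theorem two_mul_fitDet :
    2 * fitDet s w x = ∑ i ∈ s, ∑ j ∈ s, w i * w j * (x i - x j) ^ 2 := by
  have e1 : fitS0 s w * fitSxx s w x = ∑ i ∈ s, ∑ j ∈ s, w i * (w j * x j ^ 2) := by
    rw [fitS0, fitSxx, Finset.sum_mul_sum]
  have e1' : fitSxx s w x * fitS0 s w = ∑ i ∈ s, ∑ j ∈ s, w i * x i ^ 2 * w j := by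
    rw [fitS0, fitSxx, Finset.sum_mul_sum]
  have e2 : fitSx s w x * fitSx s w x = ∑ i ∈ s, ∑ j ∈ s, w i * x i * (w j * x j) := by
    rw [fitSx, Finset.sum_mul_sum]
  have h : 2 * fitDet s w x =
      fitS0 s w * fitSxx s w x + fitSxx s w x * fitS0 s w - 2 * (fitSx s w x * fitSx s w x) := by
    unfold fitDet; ring
  rw [h, e1, e1', e2, Finset.mul_sum, ← Finset.sum_add_distrib, ← Finset.sum_sub_distrib]
  refine Finset.sum_congr rfl fun i _ => ?_
  rw [Finset.mul_sum, ← Finset.sum_add_distrib, ← Finset.sum_sub_distrib]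
  exact Finset.sum_congr rfl fun j _ => by ring

/-- Non-negative weights give `Δ ≥ 0`. -/
theorem fitDet_nonneg (hw : ∀ i ∈ s, 0 ≤ w i) : 0 ≤ fitDet s w x := by
  have h := two_mul_fitDet s w x
  have : 0 ≤ ∑ i ∈ s, ∑ j ∈ s, w i * w j * (x i - x j) ^ 2 :=
    Finset.sum_nonneg fun i hi => Finset.sum_nonneg fun j hj =>
      mul_nonneg (mul_nonneg (hw i hi) (hw j hj)) (sq_nonneg _)
  linarith

/-- **The fit exists as soon as two abscissae differ**: positive weights and `xᵢ ≠ xⱼ` for some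
`i, j ∈ s` give `Δ > 0`. -/
theorem fitDet_pos (hw : ∀ i ∈ s, 0 < w i) {i j : ι} (hi : i ∈ s) (hj : j ∈ s) (hx : x i ≠ x j) :
    0 < fitDet s w x := by
  have h := two_mul_fitDet s w x
  have hnn : ∀ a ∈ s, ∀ b ∈ s, 0 ≤ w a * w b * (x a - x b) ^ 2 := fun a ha b hb =>
    mul_nonneg (mul_nonneg (hw a ha).le (hw b hb).le) (sq_nonneg _)
  have hij : 0 < w i * w j * (x i - x j) ^ 2 :=
    mul_pos (mul_pos (hw i hi) (hw j hj)) (pow_pos (abs_pos.mpr (sub_ne_zero.mpr hx)) 2 |>.trans_eq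
      (sq_abs _))
  have h1 : w i * w j * (x i - x j) ^ 2 ≤ ∑ b ∈ s, w i * w b * (x i - x b) ^ 2 :=
    Finset.single_le_sum (f := fun b => w i * w b * (x i - x b) ^ 2) (fun b hb => hnn i hi b hb) hj
  have h2 : ∑ b ∈ s, w i * w b * (x i - x b) ^ 2 ≤ ∑ a ∈ s, ∑ b ∈ s, w a * w b * (x a - x b) ^ 2 :=
    Finset.single_le_sum (f := fun a => ∑ b ∈ s, w a * w b * (x a - x b) ^ 2)
      (fun a ha => Finset.sum_nonneg fun b hb => hnn a ha b hb) hi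
  linarith

/-! ## Linearity of the exponent in the data -/

/-- Weighted sums of an affine expression in `x` (bookkeeping). -/
theorem sum_mul_affine (A B : ℝ) :
    ∑ i ∈ s, w i * (A * x i - B) = A * fitSx s w x - B * fitS0 s w := by
  rw [fitSx, fitS0, Finset.mul_sum, Finset.mul_sum, ← Finset.sum_sub_distrib]
  exact Finset.sum_congr rfl fun i _ => by ring

/-- The same against `x`: `Σ w (Ax − B) x = A Sₓₓ − B Sₓ`. -/
theorem sum_mul_affine_mul (A B : ℝ) :
    ∑ i ∈ s, w i * (A * x i - B) * x i = A * fitSxx s w x - B * fitSx s w x := by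
  rw [fitSxx, fitSx, Finset.mul_sum, Finset.mul_sum, ← Finset.sum_sub_distrib]
  exact Finset.sum_congr rfl fun i _ => by ring

/-- And squared: `Σ w (Ax − B)² = A² Sₓₓ − 2AB Sₓ + B² S₀`. -/
theorem sum_mul_affine_sq (A B : ℝ) :
    ∑ i ∈ s, w i * (A * x i - B) ^ 2 = A ^ 2 * fitSxx s w x - 2 * A * B * fitSx s w x + B ^ 2 * fitS0 s w := by
  rw [fitSxx, fitSx, fitS0, Finset.mul_sum, Finset.mul_sum, Finset.mul_sum, ← Finset.sum_sub_distrib,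
    ← Finset.sum_add_distrib]
  exact Finset.sum_congr rfl fun i _ => by ring

/-- **The exponent is linear in the ordinates**: `z = Σᵢ cᵢ yᵢ`. -/
theorem fitSlope_eq_sum_fitCoef : fitSlope s w x y = ∑ i ∈ s, fitCoef s w x i * y i := by
  unfold fitSlope fitCoef fitSxy fitSy
  rw [Finset.mul_sum, Finset.mul_sum, ← Finset.sum_sub_distrib, Finset.sum_div]
  exact Finset.sum_congr rfl fun i _ => by ring

/-- The coefficients sum to zero: `Σ cᵢ = 0` (whatever `Δ`). -/
theorem sum_fitCoef : ∑ i ∈ s, fitCoef s w x i = 0 := by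
  unfold fitCoef
  rw [← Finset.sum_div, sum_mul_affine, mul_comm, sub_self, zero_div]

/-- The coefficients reproduce the abscissa: `Σ cᵢ xᵢ = 1` (`Δ ≠ 0`). -/
theorem sum_fitCoef_mul (hD : fitDet s w x ≠ 0) : ∑ i ∈ s, fitCoef s w x i * x i = 1 := by
  unfold fitCoef
  have : ∑ i ∈ s, w i * (fitS0 s w * x i - fitSx s w x) / fitDet s w x * x i =
      (∑ i ∈ s, w i * (fitS0 s w * x i - fitSx s w x) * x i) / fitDet s w x := by
    rw [Finset.sum_div]
    exact Finset.sum_congr rfl fun i _ => by ring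
  rw [this, sum_mul_affine_mul, div_eq_one_iff_eq hD, fitDet]
  ring

/-- **A `ξ`-independent factor cannot move the exponent.**  Replacing every `τᵢ` by `e^{c} τᵢ`
(`yᵢ ↦ yᵢ + c`: a constant-factor speed-up of one algorithm, or a constant per-trajectory cost
factor) leaves the fitted exponent unchanged — for every weight vector and every `Δ`. -/
theorem fitSlope_add_const (c : ℝ) : fitSlope s w x (fun i => y i + c) = fitSlope s w x y := by
  rw [fitSlope_eq_sum_fitCoef, fitSlope_eq_sum_fitCoef]
  simp only [mul_add, Finset.sum_add_distrib, ← Finset.sum_mul, sum_fitCoef, zero_mul, add_zero]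

/-- **A factor growing like `ξ^a` moves the exponent by exactly `a`.**  `yᵢ ↦ yᵢ + (a xᵢ + c)`
(`τ ↦ C ξ^a τ`, e.g. folding in a per-trajectory cost `C ξ^a`) gives slope `z + a` (`Δ ≠ 0`). -/
theorem fitSlope_add_affine (hD : fitDet s w x ≠ 0) (a c : ℝ) :
    fitSlope s w x (fun i => y i + (a * x i + c)) = fitSlope s w x y + a := by
  rw [fitSlope_eq_sum_fitCoef, fitSlope_eq_sum_fitCoef]
  have : ∀ i ∈ s, fitCoef s w x i * (y i + (a * x i + c)) =
      fitCoef s w x i * y i + a * (fitCoef s w x i * x i) + c * fitCoef s w x i := fun i _ => by ring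
  rw [Finset.sum_congr rfl this, Finset.sum_add_distrib, Finset.sum_add_distrib, ← Finset.mul_sum,
    ← Finset.mul_sum, sum_fitCoef_mul s w x hD, sum_fitCoef, mul_one, mul_zero, add_zero]

/-- **Exact on power laws**: data lying on `y = a x + c` (`τ = e^{c} ξ^a`) fit to slope `a` … -/
theorem fitSlope_affine (hD : fitDet s w x ≠ 0) (a c : ℝ) :
    fitSlope s w x (fun i => a * x i + c) = a := by
  have h := fitSlope_add_affine s w x (fun _ => 0) hD a c
  have h0 : fitSlope s w x (fun _ => (0 : ℝ)) = 0 := by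
    rw [fitSlope_eq_sum_fitCoef]; simp
  simpa [h0] using h

/-- Weighted sums of affine data: `S_y = a Sₓ + c S₀`. -/
theorem fitSy_affine (a c : ℝ) : fitSy s w (fun i => a * x i + c) = a * fitSx s w x + c * fitS0 s w := by
  rw [fitSy, fitSx, fitS0, Finset.mul_sum, Finset.mul_sum, ← Finset.sum_add_distrib]
  exact Finset.sum_congr rfl fun i _ => by ring

/-- Weighted sums of affine data: `S_xy = a Sₓₓ + c Sₓ`. -/
theorem fitSxy_affine (a c : ℝ) :
    fitSxy s w x (fun i => a * x i + c) = a * fitSxx s w x + c * fitSx s w x := by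
  rw [fitSxy, fitSxx, fitSx, Finset.mul_sum, Finset.mul_sum, ← Finset.sum_add_distrib]
  exact Finset.sum_congr rfl fun i _ => by ring

/-- … and to intercept `c` (`ln A`). -/
theorem fitIntercept_affine (hD : fitDet s w x ≠ 0) (a c : ℝ) :
    fitIntercept s w x (fun i => a * x i + c) = c := by
  rw [fitIntercept, fitSy_affine, fitSxy_affine, div_eq_iff hD, fitDet]
  ring

/-- Weighted sums under a common rescaling of the weights. -/
theorem fitSums_smul (k : ℝ) :
    fitS0 s (fun i => k * w i) = k * fitS0 s w ∧ fitSx s (fun i => k * w i) x = k * fitSx s w x ∧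
    fitSxx s (fun i => k * w i) x = k * fitSxx s w x ∧ fitSy s (fun i => k * w i) y = k * fitSy s w y ∧
    fitSxy s (fun i => k * w i) x y = k * fitSxy s w x y := by
  refine ⟨?_, ?_, ?_, ?_, ?_⟩
  · rw [fitS0, fitS0, Finset.mul_sum]
  · rw [fitSx, fitSx, Finset.mul_sum]; exact Finset.sum_congr rfl fun i _ => by ring
  · rw [fitSxx, fitSxx, Finset.mul_sum]; exact Finset.sum_congr rfl fun i _ => by ring
  · rw [fitSy, fitSy, Finset.mul_sum]; exact Finset.sum_congr rfl fun i _ => by ring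
  · rw [fitSxy, fitSxy, Finset.mul_sum]; exact Finset.sum_congr rfl fun i _ => by ring

/-- **A common rescaling of the weights is immaterial** (`k ≠ 0`): only relative weights matter,
so `w = (τ/δτ)²` and `w = 1/Var(ln τ)` in any common unit give the same exponent. -/
theorem fitSlope_smul_weight {k : ℝ} (hk : k ≠ 0) :
    fitSlope s (fun i => k * w i) x y = fitSlope s w x y := by
  obtain ⟨h0, hx, hxx, hy, hxy⟩ := fitSums_smul s w x y k
  have hD : fitDet s (fun i => k * w i) x = k ^ 2 * fitDet s w x := by
    rw [fitDet, fitDet, h0, hx, hxx]; ring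
  rw [fitSlope, fitSlope, hD, h0, hx, hy, hxy]
  rw [show k * fitS0 s w * (k * fitSxy s w x y) - k * fitSx s w x * (k * fitSy s w y) =
      k ^ 2 * (fitS0 s w * fitSxy s w x y - fitSx s w x * fitSy s w y) by ring]
  exact mul_div_mul_left _ _ (pow_ne_zero 2 hk)

/-! ## Least squares: the normal equations and optimality -/

/-- First normal equation: `b̂ S₀ + ẑ Sₓ = S_y` (`Δ ≠ 0`). -/
theorem fitIntercept_normalEq (hD : fitDet s w x ≠ 0) :
    fitIntercept s w x y * fitS0 s w + fitSlope s w x y * fitSx s w x = fitSy s w y := by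
  unfold fitIntercept fitSlope
  rw [div_mul_eq_mul_div, div_mul_eq_mul_div, ← add_div, div_eq_iff hD, fitDet]
  ring

/-- Second normal equation: `b̂ Sₓ + ẑ Sₓₓ = S_xy` (`Δ ≠ 0`). -/
theorem fitSlope_normalEq (hD : fitDet s w x ≠ 0) :
    fitIntercept s w x y * fitSx s w x + fitSlope s w x y * fitSxx s w x = fitSxy s w x y := by
  unfold fitIntercept fitSlope
  rw [div_mul_eq_mul_div, div_mul_eq_mul_div, ← add_div, div_eq_iff hD, fitDet]
  ring

/-- **Completing the square**: for every line `b + z x`,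
`χ²(b, z) = χ²(b̂, ẑ) + Σ w ((b − b̂) + (z − ẑ) x)²` (`Δ ≠ 0`; the cross term vanishes by the
normal equations). -/
theorem fitChiSq_eq_add (hD : fitDet s w x ≠ 0) (b z : ℝ) :
    fitChiSq s w x y b z = fitChiSq s w x y (fitIntercept s w x y) (fitSlope s w x y) +
      ∑ i ∈ s, w i * ((b - fitIntercept s w x y) + (z - fitSlope s w x y) * x i) ^ 2 := by
  set bh := fitIntercept s w x y with hbh
  set zh := fitSlope s w x y with hzh
  have n1 := fitIntercept_normalEq s w x y hD
  have n2 := fitSlope_normalEq s w x y hD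
  rw [← hbh, ← hzh] at n1 n2
  -- the cross term: Σ w (y − bh − zh x) ((b − bh) + (z − zh) x) = 0
  have cross : ∑ i ∈ s, w i * (y i - (bh + zh * x i)) * ((b - bh) + (z - zh) * x i) = 0 := by
    have : ∀ i ∈ s, w i * (y i - (bh + zh * x i)) * ((b - bh) + (z - zh) * x i) =
        (b - bh) * (w i * y i) - (b - bh) * bh * w i - (b - bh) * zh * (w i * x i) +
        (z - zh) * (w i * (x i * y i)) - (z - zh) * bh * (w i * x i) -
        (z - zh) * zh * (w i * x i ^ 2) := fun i _ => by ring
    rw [Finset.sum_congr rfl this]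
    simp only [Finset.sum_sub_distrib, Finset.sum_add_distrib, ← Finset.mul_sum]
    rw [← fitSy, ← fitS0, ← fitSx, ← fitSxy, ← fitSxx]
    linear_combination (bh - b) * n1 + (zh - z) * n2
  unfold fitChiSq
  have : ∀ i ∈ s, w i * (y i - (b + z * x i)) ^ 2 =
      w i * (y i - (bh + zh * x i)) ^ 2 + w i * ((b - bh) + (z - zh) * x i) ^ 2 -
      2 * (w i * (y i - (bh + zh * x i)) * ((b - bh) + (z - zh) * x i)) := fun i _ => by ring
  rw [Finset.sum_congr rfl this, Finset.sum_sub_distrib, Finset.sum_add_distrib, ← Finset.mul_sum,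
    cross, mul_zero, sub_zero]

/-- **The closed form is the least-squares minimiser** (non-negative weights, `Δ ≠ 0`):
`χ²(b̂, ẑ) ≤ χ²(b, z)` for every `b, z`. -/
theorem fitChiSq_min (hD : fitDet s w x ≠ 0) (hw : ∀ i ∈ s, 0 ≤ w i) (b z : ℝ) :
    fitChiSq s w x y (fitIntercept s w x y) (fitSlope s w x y) ≤ fitChiSq s w x y b z := by
  rw [fitChiSq_eq_add s w x y hD b z]
  exact le_add_of_nonneg_right (Finset.sum_nonneg fun i hi => mul_nonneg (hw i hi) (sq_nonneg _))

/-! ## The error bar of the exponent -/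

/-- **`Σ cᵢ²/wᵢ = S₀/Δ`** (`wᵢ ≠ 0`, `Δ ≠ 0`): with independent ordinates of variance
`Var(yᵢ) = 1/wᵢ`, the variance of the linear statistic `z = Σ cᵢ yᵢ` is `Σ cᵢ² Var(yᵢ) = S₀/Δ` —
the `δz²` of the report.  It is a function of the weights and abscissae alone. -/
theorem sum_fitCoef_sq_div (hD : fitDet s w x ≠ 0) (hw : ∀ i ∈ s, w i ≠ 0) :
    ∑ i ∈ s, fitCoef s w x i ^ 2 / w i = fitS0 s w / fitDet s w x := by
  have : ∀ i ∈ s, fitCoef s w x i ^ 2 / w i =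
      w i * (fitS0 s w * x i - fitSx s w x) ^ 2 / fitDet s w x ^ 2 := by
    intro i hi
    have hwi := hw i hi
    rw [fitCoef, div_pow, mul_pow, sq (w i), mul_assoc, mul_div_assoc, mul_div_assoc,
      ← mul_div_assoc, mul_div_cancel_left₀ _ hwi]
  rw [Finset.sum_congr rfl this, ← Finset.sum_div, sum_mul_affine_sq, div_eq_div_iff (pow_ne_zero 2 hD) hD,
    fitDet]
  ring

/-! ## The verdict statistic -/

/-- `σ_comb = √(δ₁² + δ₂²)`. -/
def sigmaComb (δ₁ δ₂ : ℝ) : ℝ := Real.sqrt (δ₁ ^ 2 + δ₂ ^ 2)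

/-- The verdict statistic `(z₂ − z₁)/σ_comb` ("exponents equal within 2σ_comb" = modulus `≤ 2`). -/
def exponentZ (z₁ δ₁ z₂ δ₂ : ℝ) : ℝ := (z₂ - z₁) / sigmaComb δ₁ δ₂

/-- `σ_comb` is symmetric. -/
theorem sigmaComb_comm (δ₁ δ₂ : ℝ) : sigmaComb δ₁ δ₂ = sigmaComb δ₂ δ₁ := by
  rw [sigmaComb, sigmaComb, add_comm]

/-- Each error bar is below `σ_comb`: `|δ₁| ≤ σ_comb`. -/
theorem abs_le_sigmaComb (δ₁ δ₂ : ℝ) : |δ₁| ≤ sigmaComb δ₁ δ₂ := by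
  rw [sigmaComb, ← Real.sqrt_sq_eq_abs]
  exact Real.sqrt_le_sqrt (le_add_of_nonneg_right (sq_nonneg _))

/-- Swapping the two arms flips the sign of the statistic (the verdict `|·| ≤ 2` is symmetric). -/
theorem exponentZ_swap (z₁ δ₁ z₂ δ₂ : ℝ) : exponentZ z₂ δ₂ z₁ δ₁ = -exponentZ z₁ δ₁ z₂ δ₂ := by
  rw [exponentZ, exponentZ, sigmaComb_comm δ₂ δ₁, ← neg_div, neg_sub]

/-- **A common shift of both exponents leaves the statistic unchanged.** -/
theorem exponentZ_add (z₁ δ₁ z₂ δ₂ a : ℝ) :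
    exponentZ (z₁ + a) δ₁ (z₂ + a) δ₂ = exponentZ z₁ δ₁ z₂ δ₂ := by
  rw [exponentZ, exponentZ, add_sub_add_right_eq_sub]

/-- **MD units or cost units: the same verdict.**  If both arms' per-trajectory costs are
`C_arm ξ^a` with a common growth exponent `a` (any constants `C_H, C_T`), then folding the cost into
`τ` shifts both fitted exponents by `a` (`fitSlope_add_affine`, arm-wise weights `w_H, w_T`, common
abscissae) and the verdict statistic — whose error bars are ordinate-free (`sum_fitCoef_sq_div`) —
is unchanged. -/
theorem exponentZ_costUnits {wH wT yH yT : ι → ℝ} (hH : fitDet s wH x ≠ 0) (hT : fitDet s wT x ≠ 0)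
    (δ₁ δ₂ a cH cT : ℝ) :
    exponentZ (fitSlope s wH x fun i => yH i + (a * x i + cH)) δ₁
        (fitSlope s wT x fun i => yT i + (a * x i + cT)) δ₂ =
      exponentZ (fitSlope s wH x yH) δ₁ (fitSlope s wT x yT) δ₂ := by
  rw [fitSlope_add_affine s wH x yH hH, fitSlope_add_affine s wT x yT hT, exponentZ_add]

/-! ## Record numbers of the rung (printed roundings; public after the unseal) -/

/-- **S0-D1 exponents**: with the committed `z(Q²) = 4.18(17)` (HMC) and `4.10(16)` (THMC),
`|4.10 − 4.18| < √(0.17² + 0.16²)` — the two exponents agree within ONE `σ_comb` (the report's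
full-precision statistic is `−0.33`), a fortiori within the acceptance test's `2σ_comb`. -/
theorem s0d1_exponents_within : |(4.10 : ℝ) - 4.18| < 1 * sigmaComb 0.17 0.16 := by
  rw [one_mul, sigmaComb, show |(4.10 : ℝ) - 4.18| = 0.08 by norm_num [abs_of_neg]]
  rw [show (0.17 : ℝ) ^ 2 + 0.16 ^ 2 = 0.0545 by norm_num]
  rw [Real.lt_sqrt (by norm_num)]
  norm_num

/-- The same in the acceptance test's form: `|exponentZ| < 2` on the printed roundings. -/
theorem s0d1_exponentZ_lt_two : |exponentZ 4.18 0.17 4.10 0.16| < 2 := by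
  have hs : 0 < sigmaComb 0.17 0.16 := by
    unfold sigmaComb; exact Real.sqrt_pos.mpr (by norm_num)
  rw [exponentZ, abs_div, abs_of_pos hs, div_lt_iff₀ hs]
  have h := s0d1_exponents_within
  linarith

/-- **S0-D1 per-β ratios**: the committed τ_int(Q²) ratios THMC/HMC `0.795 / 0.715 / 0.87`
(β = 0.80 / 0.85 / 0.90) against the unsealed printed ratios `0.741 / 0.767 / 0.672` are each within
the factor-two band `[0.5, 2]` of the acceptance test (ours/sealed `≈ 1.07 / 0.93 / 1.29`). -/
theorem s0d1_ratios_within :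
    (1 / 2 : ℝ) ≤ 0.795 / 0.741 ∧ (0.795 / 0.741 : ℝ) ≤ 2 ∧
    (1 / 2 : ℝ) ≤ 0.715 / 0.767 ∧ (0.715 / 0.767 : ℝ) ≤ 2 ∧
    (1 / 2 : ℝ) ≤ 0.87 / 0.672 ∧ (0.87 / 0.672 : ℝ) ≤ 2 := by
  norm_num

end Summit.Ventures.LatticeQCDFlow.Scoring

end
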